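import Literature.Analysis.FluidPDE.TaoLocalisedEnstrophy
import HarnessLib

/-!
# Tao (2011/2013), proof of Thm. 10.1: the nonlinear (vortex-stretching) estimate `Y₆` (named fact)

The one step of the §10 argument (arXiv:1108.1165, pp. 31–33) that this decomposition does not
reproduce: the bound for the nonlinear term

  `Y₆ := ∫ O(ω ω ∇u) η = ∫ ⟨ω, (ω·∇)u⟩ η`

of the enstrophy identity (10.11), "the most difficult term", obtained by a Whitney decomposition
of the support of `η`, the local Biot–Savart law `u = O(Δ⁻¹∇(ψᵢω)) + v` with `v` harmonic on
`2Bᵢ`, Sobolev and Poincaré inequalities on balls, the mean-value principle, Plancherel, and a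
parent-ball chaining argument (pp. 32–33, from "We now turn to the most difficult term, namely the
nonlinear term `Y₆`" to "Putting the `Y₆,₁` bounds together, we conclude that
`Y₆,₁ ≲ c^{-0.15}δ³W^{3/2} + c^{0.05}δ^{-1}W^{1/2}Y₁`", together with
"`Y₆,₂ ≲ c^{0.9}Y₂ + c^{0.75}W/T`"). It is a *static* statement about a smooth divergence-free
field `u` on `ℝ³` at a fixed time, the Lipschitz cutoff `η` (Tao: `η = min(max(0, c^{-0.1}δ²(R' −
|x|)), 1)` on the ball; here its annular form of Remark 10.6, `NS.annularRamp`, with the same slope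
`k = c^{-0.1}δ²`, so that `η ∼ c^{-0.1}δ²rᵢ` on the Whitney balls, (10.20)), the localised
enstrophy `W = ½∫|ω|²η` ((10.15), `NS.localisedEnstrophy`) and dissipation `Y₁ = ∫|∇ω|²η`
(`NS.localisedEnstrophyDissipation`, Frobenius norm), the energy input of Lemma 8.1 in the form
`∫|u|² ≤ 2E` with the smallness `δ⁵E^{1/2}T ≤ c` of (10.2) (used in "`r_i^{-3/2}‖u‖_{L²(2Bᵢ)} ≲
c^{-0.15}δ³E₀^{1/2}` […] the contribution of this case is `O(c^{-0.25}δ⁵E₀^{1/2}W) = O(c^{0.75}W/T)`"),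
and the recession quantity `Y₂ = ½c⁻¹‖u‖_{L^∞}∫|ω|²|∇η| = (k/2c)‖u‖_{L^∞}∫_{layers}|ω|²` of (10.12)–(10.13)
(used in "the contribution of this term to `Y₆,₂` is `O(c^{0.9}Y₂)`").

Everything else in §10 — the speed integral and the moving cutoff, the enstrophy identity against
the Lipschitz cutoff, the heat-flux bound `Y₃ ≲ b(t)` and the pigeonholing of the radii, the
transport bound `Y₄ ≲ cY₂`, the continuity method, the extraction of the conclusion — consists of
proved bricks in the sibling files (`TaoSpeedIntegral`, `TaoMovingCutoff`, `TaoLocalisedEnstrophy`,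
`TaoEnstrophyIdentity`, `TaoHeatFlux`, `TaoPigeonhole`, `TaoEnstrophyContinuity`), to be assembled
with this fact into the annular form of Thm. 10.1 (`NS.tao2011_enstrophyLocalisation_annulus_apriori_unit`).
The statement is recorded twice: as a schema `NS.tao2011_nonlinearEstimateWith K` with the constant
`K` as a parameter (the form threaded through the assembly), and as the printed assertion
`NS.tao2011_nonlinearEstimate = ∃ K > 0, NS.tao2011_nonlinearEstimateWith K` (the named fact).

## References

* T. Tao, *Localisation and compactness properties of the Navier–Stokes global regularity
  problem*, Anal. PDE 6 (2013) 25–107 = arXiv:1108.1165 (`Tao2011`), §10, proof of Thm. 10.1,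
  the estimates for `Y₆ = Y₆,₁ + Y₆,₂` ((10.19)–(10.23), arXiv pp. 31–33) and Remark 10.6
  (arXiv Rem. 64) for the annular geometry.
-/

noncomputable section

open MeasureTheory Set
open scoped RealInnerProductSpace ContDiff

namespace Literature.Analysis.FluidPDE

/-- Local notation for physical space `ℝ³ = EuclideanSpace ℝ (Fin 3)`. -/
local notation "ℝ³" => EuclideanSpace ℝ (Fin 3)

/-- **Tao 2011, proof of Thm. 10.1: the nonlinear estimate for `Y₆`** (arXiv pp. 31–33, annular
form per Remark 10.6), unit viscosity. There is an absolute constant `K` such that for all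
`0 < c ≤ 1`, `δ, T > 0`, `E ≥ 0` with `δ⁵E^{1/2}T ≤ c`, every `u ∈ C^∞(ℝ³; ℝ³)` with `div u = 0`
and `∫|u|² ≤ 2E`, every `s` with `|u(x)| ≤ s` for all `x` (the speed `‖u‖_{L^∞}`), every centre
`x₀` and radii `0 < a`, `a + 2ℓ < b` (`ℓ = k⁻¹`, `k = c^{-1/10}δ²`), writing
`η = annularRamp k a b ‖· − x₀‖`, `ω = curl u`, `W = ½∫|ω|²η`, `Y₁ = ∫|∇ω|²_F η` and
`Y₂ = (k/2c) s ∫_{layers} |ω|²` (layers `= {a < ‖x−x₀‖ < a+ℓ} ∪ {b−ℓ < ‖x−x₀‖ < b}`):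
`|∫⟨ω, (ω·∇)u⟩ η| ≤ K (c^{-3/20}δ³ W·W^{1/2} + c^{1/20}δ⁻¹ W^{1/2} Y₁ + c^{3/4} W/T) + K c^{9/10} Y₂`
(Tao: "`Y₆,₁ ≲ c^{-0.15}δ³W^{3/2} + c^{0.05}δ^{-1}W^{1/2}Y₁`", "`Y₆,₂ ≲ c^{0.9}Y₂ + c^{0.75}W/T`").
The printed proof (Whitney decomposition, local Biot–Savart law, Sobolev/Poincaré on balls,
mean-value principle, Plancherel, parent-ball chaining) is not reproduced. This is the
statement with a *given* constant `K` (a schema used to thread the constant through the assembly);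
the printed assertion is `tao2011_nonlinearEstimate = ∃ K > 0, tao2011_nonlinearEstimateWith K`. [cite: Tao2011, §10, proof of Thm. 10.1 ((10.19)–(10.23)) + Remark 10.6] -/
def tao2011_nonlinearEstimateWith (K : ℝ) : Prop :=
    ∀ ⦃c δ T E : ℝ⦄, 0 < c → c ≤ 1 → 0 < δ → 0 < T → 0 ≤ E → δ ^ 5 * Real.sqrt E * T ≤ c →
    ∀ ⦃u : ℝ³ → ℝ³⦄, ContDiff ℝ ∞ u → VectorCalculus.IsDivFree u →
      (∫ x, ‖u x‖ ^ 2) ≤ 2 * E → Integrable (fun x => ‖u x‖ ^ 2) →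
    ∀ ⦃s : ℝ⦄, (∀ x, ‖u x‖ ≤ s) →
    ∀ (x₀ : ℝ³) ⦃a b : ℝ⦄, 0 < a →
      a + 2 * (c ^ (-(1 / 10 : ℝ)) * δ ^ 2)⁻¹ < b →
      |∫ x, ⟪FluidPDE.curl u x, FluidPDE.convect (FluidPDE.curl u) u x⟫ *
          annularRamp (c ^ (-(1 / 10 : ℝ)) * δ ^ 2) a b ‖x - x₀‖| ≤
        K * (c ^ (-(3 / 20 : ℝ)) * δ ^ 3 *
              (localisedEnstrophy (fun x => annularRamp (c ^ (-(1 / 10 : ℝ)) * δ ^ 2) a b ‖x - x₀‖)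
                  (u) *
                Real.sqrt (localisedEnstrophy
                  (fun x => annularRamp (c ^ (-(1 / 10 : ℝ)) * δ ^ 2) a b ‖x - x₀‖) u)) +
            c ^ (1 / 20 : ℝ) * δ⁻¹ *
              (Real.sqrt (localisedEnstrophy
                  (fun x => annularRamp (c ^ (-(1 / 10 : ℝ)) * δ ^ 2) a b ‖x - x₀‖) u) *
                localisedEnstrophyDissipation
                  (fun x => annularRamp (c ^ (-(1 / 10 : ℝ)) * δ ^ 2) a b ‖x - x₀‖) u) +
            c ^ (3 / 4 : ℝ) *
              localisedEnstrophy (fun x => annularRamp (c ^ (-(1 / 10 : ℝ)) * δ ^ 2) a b ‖x - x₀‖)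
                u / T) +
          K * c ^ (9 / 10 : ℝ) *
            ((c ^ (-(1 / 10 : ℝ)) * δ ^ 2) / (2 * c) * s *
              ∫ x in {x : ℝ³ | (a < ‖x - x₀‖ ∧ ‖x - x₀‖ < a + (c ^ (-(1 / 10 : ℝ)) * δ ^ 2)⁻¹) ∨
                  (b - (c ^ (-(1 / 10 : ℝ)) * δ ^ 2)⁻¹ < ‖x - x₀‖ ∧ ‖x - x₀‖ < b)},
                ‖FluidPDE.curl u x‖ ^ 2)

/-- **Tao 2011, proof of Thm. 10.1: the nonlinear estimate for `Y₆`** (arXiv pp. 31–33, annular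
form per Remark 10.6), unit viscosity: there is an absolute constant `K > 0` such that
`|Y₆| = |∫⟨ω, (ω·∇)u⟩ η| ≤ K (c^{-3/20}δ³ W^{3/2} + c^{1/20}δ⁻¹ W^{1/2} Y₁ + c^{3/4} W/T) + K c^{9/10} Y₂`
for the Lipschitz annular cutoff `η` of slope `c^{-1/10}δ²`, under `∫|u|² ≤ 2E`, `δ⁵E^{1/2}T ≤ c`
(see `tao2011_nonlinearEstimateWith` for the full dictionary; Tao:
"`Y₆,₁ ≲ c^{-0.15}δ³W^{3/2} + c^{0.05}δ^{-1}W^{1/2}Y₁`", "`Y₆,₂ ≲ c^{0.9}Y₂ + c^{0.75}W/T`"). The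
printed proof (Whitney decomposition, local Biot–Savart law, Sobolev/Poincaré on balls, mean-value
principle, Plancherel, parent-ball chaining) is not reproduced. [cite: Tao2011, §10, proof of Thm. 10.1 ((10.19)–(10.23)) + Remark 10.6] -/
def tao2011_nonlinearEstimate : Prop :=
  ∃ K : ℝ, 0 < K ∧ tao2011_nonlinearEstimateWith K

/-- Unfolding: the nonlinear estimate is the existence of a constant for the schema. [cite: Tao2011, §10, proof of Thm. 10.1 ((10.19)–(10.23)) + Remark 10.6] -/
theorem tao2011_nonlinearEstimate_iff :
    tao2011_nonlinearEstimate ↔ ∃ K : ℝ, 0 < K ∧ tao2011_nonlinearEstimateWith K := Iff.rfl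

end Literature.Analysis.FluidPDE

end
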